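import Literature.MathematicalPhysics.QuantumFieldTheory.Balaban1983to89.Node00.N03Record
import Literature.MathematicalPhysics.QuantumFieldTheory.Balaban1983to89.Node00.Record8
import Literature.MathematicalPhysics.QuantumFieldTheory.Balaban1983to89.Node00.N24GlueThreshold
import Literature.MathematicalPhysics.QuantumFieldTheory.Balaban1983to89.B9LeafKnitNonVacuity
import Literature.MathematicalPhysics.QuantumFieldTheory.Balaban1983to89.Node00.Satisfiable
import Literature.MathematicalPhysics.QuantumFieldTheory.Balaban1983to89.B11LeafKnitProp9

/-!
# `Balaban1983to89.B11LeafUnpinnedRecord` — DAG node N07 · [Balaban1985Variational] at NODE 00's RECORD PREDICATES OF RECORD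
# `Node00.IsRecordOfRecord₅C` ∕ `IsRecordOfRecord₈C`: the [B11] bundle is still a FREE residual field (`Residual₅.Z`, untouched by the Stage-7 ∕ Stage-8
# overwrites), so N07 is UNDETERMINED over the records — given ONE record there is another over the SAME datum at which N07 FAILS at every run, and one
# at which it HOLDS (vacuously) at every run; the kernel form of «a B11-PINNING stage (`Z := Z11OfRecord θ P`) is required before `stub_N07` is typed
# over a record predicate» (pub-ymgap R422 ∕ the chair's rev-1 soundness test R433), and THE GLUE such a pin consumes

B11 = T. Bałaban, *The variational problem and background fields in renormalization group method for lattice gauge theories*, Commun. Math. Phys.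
**102** (1985) 277–309, doi:10.1007/bf01229381 [Balaban1985Variational].  The record predicates are NODE 00's: `Node00.IsRecordOfRecord₅C F N D w`
(module `Node00.Record5C`, seat pub-ymgap-node00-def: `∃ θ : Stage5Params F N, θ.Admissible ∧ D = datumOfRecord₅ F N θ ∧ w.C = D.C ∧ w.γ = θ.γ ∧ w.L = θ.L ∧
∀ P, w.up P = upOfRecord₅C F N θ P`, `upOfRecord₅C θ P = B10CompactBinding.ofPrintedAllXPNC (carriers₃ θ (θ.res.X P)) (θ.res.Y P) (θ.res.Z P) (θ.res.V P)
(θ.res.W P)`) and its Stage-8 refinement `IsRecordOfRecord₈C` (module `Node00.Record8`: `residualOfStage8` overwrites `βfun, χ, dom, E, R` and the five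
action ∕ format fields of the residual — NOT the carrier families `X, Y, Z, V, W`).

YM-PLAN Track A (HUMAN RULING D-0062), node N07: `Dag.B11_main ℓ := ℓ.b5 → ℓ.b6 → ℓ.b7 → ℓ.b8 → ℓ.b9 → ℓ.b11` (Dag.lean :203), own leaf
`b11 ↦ DagBinding.B11Leaf Z` (DagBinding :1037).  Seat `pub-ymgap-dag-n07-a` (gen 2, KNIT-BY-NAME; gen 0 landed the abstract knit `B11LeafKnit` …
`B11LeafKnitProp9`).  Companions (same census for sister nodes): `B9LeafUnpinnedRecord5` (N06, seat dag-n06-a), `B10LeafUnpinnedRecord5C` (N08, dag-n08-a),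
`B16NodeKnitRecordPinned8C` (N13 at ₇C ∕ ₈C, dag-n13-a — whose `updV` pattern §1 follows for the three families `X, Y, Z` at once).
THEOREMS ONLY (0 `def`, 0 `sorry`, standard axioms); every witness bundle is built inside a proof and is a DEGENERATE probe, not an object of record.

## WHAT IS CERTIFIED (kernel bookkeeping over NODE 00's record predicates; nothing about Bałaban's objects)

* §1 BLINDNESS.  `densOfRecord₅_updXYZ` ∕ `machineOfRecord₅_updXYZ` ∕ **`datumOfRecord₅_updXYZ`**: the density tower, the RG machine and the DATUM of a
  Stage-5 parameter do not read the residual carrier families `X` ([B8] ∕ [B10] ∕ [B12] ∕ [B13] groups), `Y` ([B9]) and `Z` ([B11]); `toStage5_updXYZ₈` (`rfl`: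
  `residualOfStage8` keeps them); **`isRecordOfRecord₅C_updXYZ` ∕ `isRecordOfRecord₈C_updXYZ`**: re-binding a record's world to carrier-swapped parameters
  is again a ₅C ∕ ₈C record over the SAME datum.
* §2 LEAF FACTS.  `b8LeafR_of_isEmpty` (the faithful [B8] leaf holds on EMPTY index types, all constants `:= 1`), `exists_not_b11Leaf` (a [B11] bundle with
  ONE member whose Theorem-1 carrier has NO configurations and a boundary datum satisfying (7): `B11.Thm1Printed` fails, hence the leaf), `exists_b11Leaf`
  (gen 0's vacuity guard `B11LeafKnitProp9.b11Leaf_of_isEmpty` on an empty index); `b11_main_iff_of_isRecordOfRecord₅C ∕ ₈C`: at a record N07 IS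
  «b8 → b9 → b11» (b4, b5, b6, b7 are theorems of the record: `Node00.b4∕b5∕b7_main_of_isRecordOfRecord₅C`, `Node00.N03_at_record₅C` — N03 OUTRIGHT, R443).
* §3 CENSUS.  Given ONE ₅C (resp. ₈C) record `(D, w)`: **`exists_record₅C_not_b11_main`** (a ₅C record over `D` at which N07 FAILS at every run: `X ↦` empty
  [B8] indices, `Y ↦` n06's degenerate bundle with vanishing operators — so b8, b9 hold by `b8LeafR_of_isEmpty` ∕ `B9LeafKnitNonVacuity.exists_b9LeafX_of_vanishing_operators` — and `Z ↦` the refuting bundle),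
  **`exists_record₅C_b11_main`** (one at which the leaf, hence N07, HOLDS at every run — vacuously), `not_forall_record₅C_b11_main`, the ₈C twins, and the
  absolute form **`b11_main_undetermined_over_record₅C`** (records exist: `Node00.N24_exists_isRecordOfRecord₅C`, seat dag-n24-a).  CONSEQUENCE (plan ∕
  node00-def ∕ chair): a crux or stub reading «`∀ D w, IsRecordOfRecord₅C∕₈C F N D w → ∀ P, Dag.B11_main (leavesP w P)`» is refutable as typed and its
  `∃`-dual is junk-provable; the [B11] group must be PINNED — `Z` a function of genuine parameters whose Theorem-1 carrier is NODE 00's variational problem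
  (`Node00.UkExists` ∕ `UniqueUkOrbit` ∕ `UkInSpaceB11` of `Node00/BackgroundActionOfRecord` + `BackgroundCurrentShape`, GAPS rows G₈a-1∕2∕3) — before N07
  is typed over a record predicate; gen 0's dossier `N07-KNIT.md` §3b is the pin list.
* §4 THE GLUE A PIN CONSUMES.  `not_forall_atDatum_b11Leaf₅C` (the form «for all Stage-5 parameters of the datum» is unsatisfiable too — swap `Z`);
  **`forall_pinned_b11Leaf_iff₅C ∕ ₈C`** (the satisfiable form «for the parameters of the datum THAT BIND THE WORLD, `B11Leaf (θ.res.Z P)`» is PRECISELY the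
  world's leaf); `b11_main_of_upOfRecord₅C_of_b11Leaf` ∕ `b11_main_of_isRecordOfRecord₅C_of_leaf ∕ ₈C_of_leaf` (N07 at a record from its own leaf at the
  binding parameters — the socket a pinning stage's theorem `B11Leaf (Z11OfRecord θ P)` plugs into, cf. `Node00.N03_at_record₅C`).

HONEST FRAMING: count-neutral; N07 NOT discharged; nothing asserted about [B11] at Bałaban's objects (Theorem 1 on NODE 00's lattice objects = GAPS
G₈a-1∕2∕3 stays displayed); the §2∕§3 carriers are DEGENERATE probes; one finite T⁴ programme at fixed ε; nothing continuum ∕ ℝ⁴ ∕ OS ∕ mass-gap ∕ Clay.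
-/

noncomputable section

namespace Literature.MathematicalPhysics.QuantumFieldTheory.Balaban1983to89.B11LeafUnpinnedRecord

open DagBinding DagDischargedII T4Continuum Node00

variable {F : T4Family} {N : ℕ} [NeZero N]

/-! ## §1 Blindness of the datum to the residual carrier families `X`, `Y`, `Z`; re-binding keeps a record a record -/

/-- The Stage-5 density tower does not read the residual carrier families `X`, `Y`, `Z` (induction on `k`, each step `rfl` after the hypothesis).
[cite: Balaban1988Convergent, (0.2) p.244 (bookkeeping: the tower's dictionary reads `E` and `R` only)] -/
theorem densOfRecord₅_updXYZ (θ : Stage5Params F N) (X' : B12.RunParams → PrintedCarriersR) (Y' : B12.RunParams → PrintedCarriers9X)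
    (Z' : B12.RunParams → PrintedCarriers11) (p : B12.RunParams) :
    ∀ k, densOfRecord₅ F N { θ with res := { θ.res with X := X', Y := Y', Z := Z' } } p k = densOfRecord₅ F N θ p k
  | 0 => rfl
  | k + 1 => by
    show θ.res.R p k (TrhoOfRecord F N p.K k (densOfRecord₅ F N { θ with res := { θ.res with X := X', Y := Y', Z := Z' } } p k)) =
      θ.res.R p k (TrhoOfRecord F N p.K k (densOfRecord₅ F N θ p k))
    rw [densOfRecord₅_updXYZ θ X' Y' Z' p k]

/-- Nor does the RG machine of the record (its fields read `βfun ∕ E ∕ dom ∕ effAction ∕ wilsonBG ∕ Ek ∕ χ ∕ S218 ∕ ReprA ∕ IndA ∕ R`, never a carrier family).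
[cite: Balaban1987RG1, (0.22)–(0.24) p.256 (bookkeeping: the machine's dictionary)] -/
theorem machineOfRecord₅_updXYZ (θ : Stage5Params F N) (X' : B12.RunParams → PrintedCarriersR) (Y' : B12.RunParams → PrintedCarriers9X)
    (Z' : B12.RunParams → PrintedCarriers11) :
    machineOfRecord₅ F N { θ with res := { θ.res with X := X', Y := Y', Z := Z' } } = machineOfRecord₅ F N θ := by
  have hd : ∀ p k, densOfRecord₅ F N { θ with res := { θ.res with X := X', Y := Y', Z := Z' } } p k = densOfRecord₅ F N θ p k :=
    fun p k => densOfRecord₅_updXYZ θ X' Y' Z' p k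
  unfold machineOfRecord₅
  simp only [hd]

/-- **The Stage-5 DATUM is blind to the residual carrier families** `X`, `Y`, `Z`. [cite: Balaban1988Convergent, (0.2) p.244 (the datum is assembled from the machine and the averaging of record; bookkeeping)] -/
theorem datumOfRecord₅_updXYZ (θ : Stage5Params F N) (X' : B12.RunParams → PrintedCarriersR) (Y' : B12.RunParams → PrintedCarriers9X)
    (Z' : B12.RunParams → PrintedCarriers11) :
    datumOfRecord₅ F N { θ with res := { θ.res with X := X', Y := Y', Z := Z' } } = datumOfRecord₅ F N θ := by
  unfold datumOfRecord₅
  rw [machineOfRecord₅_updXYZ]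

/-- Nor does Stage-5 admissibility (= Stage-1 admissibility ∧ `0 < γ`). [cite: Balaban1987RG1, (0.17)–(0.20) pp.255–256 (bookkeeping: the parameter dictionary)] -/
theorem admissible_updXYZ {θ : Stage5Params F N} (hθ : θ.Admissible) (X' : B12.RunParams → PrintedCarriersR)
    (Y' : B12.RunParams → PrintedCarriers9X) (Z' : B12.RunParams → PrintedCarriers11) :
    ({ θ with res := { θ.res with X := X', Y := Y', Z := Z' } } : Stage5Params F N).Admissible :=
  hθ

/-- The Stage-5 view of carrier-swapped Stage-8 parameters is the carrier-swapped Stage-5 view (`residualOfStage8` does not overwrite `X`, `Y`, `Z`; `rfl`).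
[cite: Balaban1987RG1, (0.22) p.256 (bookkeeping: the Stage-8 substitutions)] -/
theorem toStage5_updXYZ₈ (θ : Stage8Params F N) (X' : B12.RunParams → PrintedCarriersR) (Y' : B12.RunParams → PrintedCarriers9X)
    (Z' : B12.RunParams → PrintedCarriers11) :
    Stage8Params.toStage5 F N { θ with res := { θ.res with X := X', Y := Y', Z := Z' } } =
      { Stage8Params.toStage5 F N θ with res := { (Stage8Params.toStage5 F N θ).res with X := X', Y := Y', Z := Z' } } := rfl

variable {D : FiniteEpsData F (SU N)} {w : WorldP}

/-- **Re-binding a ₅C record's world to carrier-swapped parameters is again a ₅C record over the SAME datum** — the record predicate of record does not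
constrain the [B8]∕[B9]∕[B11] families. [cite: Balaban1985Variational, Thm 1 p.279 (bookkeeping over NODE 00's record predicate: the [B11] group is residual)] -/
theorem isRecordOfRecord₅C_updXYZ (h : IsRecordOfRecord₅C F N D w) :
    ∃ θ : Stage5Params F N, θ.Admissible ∧ (∀ P, w.up P = upOfRecord₅C F N θ P) ∧
      ∀ (X' : B12.RunParams → PrintedCarriersR) (Y' : B12.RunParams → PrintedCarriers9X) (Z' : B12.RunParams → PrintedCarriers11),
        IsRecordOfRecord₅C F N D
          { w with up := fun P => upOfRecord₅C F N ({ θ with res := { θ.res with X := X', Y := Y', Z := Z' } } : Stage5Params F N) P } := by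
  obtain ⟨θ, hθ, hD, hC, hγ, hL, hup⟩ := h
  refine ⟨θ, hθ, hup, fun X' Y' Z' => ⟨{ θ with res := { θ.res with X := X', Y := Y', Z := Z' } }, hθ, ?_, hC, hγ, hL, fun _ => rfl⟩⟩
  rw [datumOfRecord₅_updXYZ]
  exact hD

/-- **Re-binding an ₈C record's world to carrier-swapped parameters is again an ₈C record over the SAME datum** (Stage 8 overwrites `βfun, χ, dom, E, R` and the
action∕format fields — not the carrier families). [cite: Balaban1985Variational, Thm 1 p.279 (bookkeeping over NODE 00's Stage-8 record predicate: the [B11] group is residual)] -/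
theorem isRecordOfRecord₈C_updXYZ (h : IsRecordOfRecord₈C F N D w) :
    ∃ θ : Stage8Params F N, θ.Admissible ∧ (∀ P, w.up P = upOfRecord₅C F N (θ.toStage5 F N) P) ∧
      ∀ (X' : B12.RunParams → PrintedCarriersR) (Y' : B12.RunParams → PrintedCarriers9X) (Z' : B12.RunParams → PrintedCarriers11),
        IsRecordOfRecord₈C F N D
          { w with up := fun P =>
              upOfRecord₅C F N (Stage8Params.toStage5 F N { θ with res := { θ.res with X := X', Y := Y', Z := Z' } }) P } := by
  obtain ⟨θ, hθ, hD, hC, hγ, hL, hup⟩ := h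
  refine ⟨θ, hθ, hup, fun X' Y' Z' => ⟨{ θ with res := { θ.res with X := X', Y := Y', Z := Z' } }, hθ, ?_, hC, hγ, hL, fun _ => rfl⟩⟩
  rw [toStage5_updXYZ₈, datumOfRecord₅_updXYZ]
  exact hD

/-! ## §2 Leaf facts: the faithful [B8] leaf on empty indices; a refuting and a satisfying [B11] bundle; N07 at a record is «b8 → b9 → b11» -/

/-- **Vacuity of the faithful [B8] leaf on EMPTY index types**: every conjunct of `DagBinding.B8LeafR` has the shape «∃ constants > 0, ∀ i, …» or «∀ i, …», so on
empty `I₁ … I₄` it holds for any carriers and constants (all constants `:= 1`).  A probe, recorded next to n05-a's knit `B8LeafKnit`.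
[cite: Balaban1985RegularSpaces, Lemma 1 – Thm 8 pp.79–101 (bookkeeping: vacuity of the typed leaf over empty family indices)] -/
theorem b8LeafR_of_isEmpty {I₁ I₂ I₃ I₄ : Type} [IsEmpty I₁] [IsEmpty I₂] [IsEmpty I₃] [IsEmpty I₄] (d : ℕ) (L C₂ B₁' B₀' B₁ B₂ c₁ : ℝ)
    (inp : B8.B9Inputs) (B₀β : ℝ) (loc : I₁ → B8.LocalData) (fam : I₂ → B8SectGH.GFData3) (lan : I₃ → B8.LandauData) (cub : I₄ → B8.CubeData)
    (toAxial : ∀ i, (fam i).Cfg → (fam i).Pert → (fam i).Pert) :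
    B8LeafR d L C₂ B₁' B₀' B₁ B₂ c₁ inp B₀β loc fam lan cub toAxial where
  l1 := ⟨1, one_pos, fun i => isEmptyElim i⟩
  t2 := ⟨1, 1, 1, one_pos, one_pos, one_pos, fun i => isEmptyElim i⟩
  p3 := ⟨1, one_pos, fun i => isEmptyElim i⟩
  t4 := ⟨1, one_pos, fun i => isEmptyElim i⟩
  p5e := ⟨1, one_pos, fun i => isEmptyElim i⟩
  p5u := ⟨1, 1, one_pos, one_pos, fun i => isEmptyElim i⟩
  p6 := fun i => isEmptyElim i
  p7 := ⟨1, one_pos, fun i => isEmptyElim i⟩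
  t8 := ⟨1, one_pos, fun i => isEmptyElim i⟩

/-- **A [B11] bundle whose leaf FAILS** (degenerate probe): ONE member (`I11 := PUnit`) whose Theorem-1 carrier has NO configurations (`Cfg := PEmpty`), one
boundary datum and (7) always satisfied — Theorem 1 would produce a minimal configuration for `ε₁ := a₁`, so `B11.Thm1Printed` fails, hence `B11Leaf`.  The
other three carriers are trivial one-point data (irrelevant to the refutation). [cite: Balaban1985Variational, Thm 1 p.279 (bookkeeping: the typed leaf is not a tautology)] -/
theorem exists_not_b11Leaf : ∃ Z : PrintedCarriers11, Nonempty Z.I11 ∧ ¬ B11Leaf Z := by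
  let Pv : B11.VarProblem :=
    ⟨PEmpty, PUnit, PEmpty, fun c => c.elim, fun c => c.elim, 0, 0, fun _ _ => True, fun _ _ => True, fun _ _ => True,
      fun _ _ _ => True, fun _ _ _ => True, fun _ _ => True, fun _ _ => 0, fun _ _ => 0, fun _ _ _ => 0, fun _ _ => 0⟩
  let Plg : B11.LGData :=
    ⟨PUnit, PUnit, PUnit, PUnit, PUnit, PUnit, PUnit, 0, 0, 0, fun _ => 0, fun _ => 0, fun _ _ => 0, fun _ _ _ _ => True,
      fun _ _ _ _ => True, fun _ _ _ => True, fun _ _ _ _ => True, fun _ _ _ => True, fun _ _ => True, fun _ _ _ => PUnit.unit,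
      fun _ _ _ => True, fun _ _ => 0, fun _ _ => True, fun _ A => A, fun _ _ => 0, fun _ _ _ _ => 0, fun _ _ => 0, fun _ _ => 0,
      fun _ _ => True, fun _ _ _ => True, fun _ _ _ => PUnit.unit, fun _ _ _ => True, fun _ _ _ => True, fun _ _ _ => True⟩
  let Px : B11.VarProblemX :=
    { Cfg := PUnit, Bdry := PUnit, Cube := PUnit, scale := fun _ => 0, sizeM := fun _ => 0, eta := 0, L := 0, InU := fun _ _ => True,
      InB := fun _ _ => True, Reg7 := fun _ _ => True, OnMinimalOrbit := fun _ _ _ => True, UniqueCriticalOrbit := fun _ _ _ => True,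
      Gauged := fun _ _ => True, normA := fun _ _ => 0, normGradA := fun _ _ => 0, holderA := fun _ _ _ => 0, normLapA := fun _ _ => 0,
      IsCritical := fun _ _ => True, SameOrbit := fun _ _ => True }
  let Pa : B11.AnData :=
    ⟨PUnit, PUnit, PUnit, 0, 0, 0, fun _ => 0, fun _ _ => 0, fun _ _ => True, fun _ => 0, fun _ _ => True, fun _ _ => True,
      fun _ _ => True, fun _ _ => True, fun _ _ _ => True, fun _ _ _ _ _ _ => 0⟩
  refine ⟨⟨PUnit, fun _ => Pv, fun _ => Plg, fun _ => Px, fun _ => Pa, 0, 0, 0, 0, 0, 0, 0, 0, 0, 0, 0, 0⟩, ⟨PUnit.unit⟩, fun hZ => ?_⟩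
  obtain ⟨a₀, a₁, B₃, B₄, Mfun, -, ha₁, -, -, -, -, H⟩ := hZ.t1
  obtain ⟨⟨U, -⟩, -⟩ := H PUnit.unit a₁ ha₁ le_rfl PUnit.unit trivial
  exact U.elim

/-- **A [B11] bundle whose leaf HOLDS** (degenerate probe): an EMPTY index — gen 0's vacuity guard `B11LeafKnitProp9.b11Leaf_of_isEmpty`.
[cite: Balaban1985Variational, Thm 1 p.279 and Props 2–9 pp.281–309 (bookkeeping: vacuity of the typed leaf over an empty family index)] -/
theorem exists_b11Leaf : ∃ Z : PrintedCarriers11, IsEmpty Z.I11 ∧ B11Leaf Z := by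
  obtain ⟨Z₁⟩ := nonempty_printedCarriers11
  let Z : PrintedCarriers11 :=
    { Z₁ with I11 := PEmpty, famV := fun i => i.elim, famLG := fun i => i.elim, famX := fun i => i.elim, famAn := fun i => i.elim }
  exact ⟨Z, (inferInstance : IsEmpty PEmpty), B11LeafKnitProp9.b11Leaf_of_isEmpty Z (inferInstance : IsEmpty PEmpty)⟩

/-- **N07 at a ₅C record IS «b8 → b9 → b11»**: the antecedents `b5`, `b6`, `b7` (and `b4`) are theorems of the record — `Node00.b4∕b5∕b7_main_of_isRecordOfRecord₅C`
(Stages 1–2) and `Node00.N03_at_record₅C` (N03 outright, R443). [cite: Balaban1985Variational, Thm 1 p.279, Props 2–9 pp.281–309 (bookkeeping: the node at a record)] -/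
theorem b11_main_iff_of_isRecordOfRecord₅C (h : IsRecordOfRecord₅C F N D w) (P : B12.RunParams) :
    Dag.B11_main (leavesP w P) ↔ ((leavesP w P).b8 → (leavesP w P).b9 → (leavesP w P).b11) := by
  have h4 : (leavesP w P).b4 := b4_main_of_isRecordOfRecord₅C h P
  have h5 : (leavesP w P).b5 := b5_main_of_isRecordOfRecord₅C h P h4
  have h6 : (leavesP w P).b6 := N03_at_record₅C h P h4 h5
  have h7 : (leavesP w P).b7 := b7_main_of_isRecordOfRecord₅C h P h5
  exact ⟨fun hN h8 h9 => hN h5 h6 h7 h8 h9, fun hN _ _ _ => hN⟩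

/-- N07 at an ₈C record IS «b8 → b9 → b11» (by refinement to ₅C). [cite: Balaban1985Variational, Thm 1 p.279, Props 2–9 pp.281–309 (bookkeeping)] -/
theorem b11_main_iff_of_isRecordOfRecord₈C (h : IsRecordOfRecord₈C F N D w) (P : B12.RunParams) :
    Dag.B11_main (leavesP w P) ↔ ((leavesP w P).b8 → (leavesP w P).b9 → (leavesP w P).b11) :=
  b11_main_iff_of_isRecordOfRecord₅C (isRecordOfRecord₅C_of_isRecordOfRecord₈C h) P

/-! ## §3 Census: N07 is undetermined over the record predicates of record -/

/-- The `b8`, `b9`, `b11` leaves of the C-binding of record at `θ`, `P`, unfolded to the residual families (`rfl` ×3: `carriers₃` keeps the [B8] group, the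
C-re-binding touches `b10` only). [cite: Balaban1985Variational, Thm 1 p.279; Balaban1985RegularSpaces, Lemma 1 – Thm 8 pp.79–101; Balaban1985BackgroundPropagators, Thms 3.1–3.15 pp.397–432 (bookkeeping)] -/
theorem upOfRecord₅C_b8_b9_b11 (θ : Stage5Params F N) (P : B12.RunParams) :
    ((upOfRecord₅C F N θ P).b8 ↔
      B8LeafR (θ.res.X P).d8 (θ.res.X P).L8 (θ.res.X P).C₂ (θ.res.X P).B₁' (θ.res.X P).B₀' (θ.res.X P).B₁ (θ.res.X P).B₂ (θ.res.X P).c₁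
        (θ.res.X P).inp8 (θ.res.X P).B₀β (θ.res.X P).loc8 (θ.res.X P).fam8R (θ.res.X P).lan8 (θ.res.X P).cub8 (θ.res.X P).toAxial8) ∧
    ((upOfRecord₅C F N θ P).b9 ↔ B9LeafX (θ.res.Y P)) ∧
    ((upOfRecord₅C F N θ P).b11 ↔ B11Leaf (θ.res.Z P)) :=
  ⟨Iff.rfl, Iff.rfl, Iff.rfl⟩

/-- **Given ONE ₅C record, there is a ₅C record over the SAME datum at which N07 FAILS at every run**: swap `X ↦` the run's bundle with EMPTY [B8] indices
(`b8` vacuously true, `b8LeafR_of_isEmpty`), `Y ↦` n06's degenerate [B9] bundle (`b9` true, `B9LeafKnitNonVacuity.exists_b9LeafX_of_vanishing_operators`), `Z ↦` the refuting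
bundle of `exists_not_b11Leaf`; then «b8 → b9 → b11» fails, i.e. N07 fails (`b11_main_iff_of_isRecordOfRecord₅C`).
[cite: Balaban1985Variational, Thm 1 p.279 (bookkeeping over NODE 00's record predicate: the [B11] group is unconstrained)] -/
theorem exists_record₅C_not_b11_main (h : IsRecordOfRecord₅C F N D w) :
    ∃ w' : WorldP, IsRecordOfRecord₅C F N D w' ∧ ∀ P : B12.RunParams, ¬ Dag.B11_main (leavesP w' P) := by
  obtain ⟨θ, -, -, hrec⟩ := isRecordOfRecord₅C_updXYZ h
  obtain ⟨Y₁, -, -, -, hY₁⟩ := B9LeafKnitNonVacuity.exists_b9LeafX_of_vanishing_operators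
  obtain ⟨Z₀, -, hZ₀⟩ := exists_not_b11Leaf
  let X' : B12.RunParams → PrintedCarriersR := fun P =>
    { θ.res.X P with
      I8a := PEmpty, I8b := PEmpty, I8c := PEmpty, I8d := PEmpty, loc8 := fun i => i.elim, fam8 := fun i => i.elim,
      lan8 := fun i => i.elim, cub8 := fun i => i.elim, toAxial8 := fun i => i.elim, C140 := fun i => i.elim, InR := fun i => i.elim,
      proj140 := fun i => i.elim }
  let Y' : B12.RunParams → PrintedCarriers9X := fun _ => Y₁
  refine ⟨_, hrec X' Y' (fun _ => Z₀), fun P hN => hZ₀ ?_⟩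
  have hθ' := upOfRecord₅C_b8_b9_b11 ({ θ with res := { θ.res with X := X', Y := Y', Z := fun _ => Z₀ } } : Stage5Params F N) P
  have h8 : (upOfRecord₅C F N ({ θ with res := { θ.res with X := X', Y := Y', Z := fun _ => Z₀ } } : Stage5Params F N) P).b8 :=
    hθ'.1.2 (@b8LeafR_of_isEmpty _ _ _ _ (inferInstance : IsEmpty PEmpty) (inferInstance : IsEmpty PEmpty)
      (inferInstance : IsEmpty PEmpty) (inferInstance : IsEmpty PEmpty) _ _ _ _ _ _ _ _ _ _ _ _ _ _ _)
  have h9 : (upOfRecord₅C F N ({ θ with res := { θ.res with X := X', Y := Y', Z := fun _ => Z₀ } } : Stage5Params F N) P).b9 :=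
    hθ'.2.1.2 hY₁
  exact hθ'.2.2.1 ((b11_main_iff_of_isRecordOfRecord₅C (hrec X' Y' (fun _ => Z₀)) P).1 hN h8 h9)

/-- **Given ONE ₅C record, there is a ₅C record over the SAME datum at which the [B11] leaf — hence N07 — HOLDS at every run** (vacuously: `Z ↦` the
empty-index bundle of `exists_b11Leaf`; `X`, `Y` unchanged). [cite: Balaban1985Variational, Thm 1 p.279 (bookkeeping: the `∃`-dual is junk-provable)] -/
theorem exists_record₅C_b11_main (h : IsRecordOfRecord₅C F N D w) :
    ∃ w' : WorldP, IsRecordOfRecord₅C F N D w' ∧ ∀ P : B12.RunParams, (leavesP w' P).b11 ∧ Dag.B11_main (leavesP w' P) := by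
  obtain ⟨θ, -, -, hrec⟩ := isRecordOfRecord₅C_updXYZ h
  obtain ⟨Z₁, -, hZ₁⟩ := exists_b11Leaf
  refine ⟨_, hrec θ.res.X θ.res.Y (fun _ => Z₁), fun P => ?_⟩
  have h11 : (upOfRecord₅C F N ({ θ with res := { θ.res with X := θ.res.X, Y := θ.res.Y, Z := fun _ => Z₁ } } : Stage5Params F N) P).b11 :=
    (upOfRecord₅C_b8_b9_b11 ({ θ with res := { θ.res with X := θ.res.X, Y := θ.res.Y, Z := fun _ => Z₁ } } : Stage5Params F N) P).2.2.2 hZ₁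
  exact ⟨h11, fun _ _ _ _ _ => h11⟩

/-- **«N07 at every run of every ₅C record world» is FALSE** (given one ₅C record). [cite: Balaban1985Variational, Thm 1 p.279 (bookkeeping: the universal form over the unpinned record is refutable)] -/
theorem not_forall_record₅C_b11_main (h : IsRecordOfRecord₅C F N D w) :
    ¬ ∀ (D' : FiniteEpsData F (SU N)) (w' : WorldP), IsRecordOfRecord₅C F N D' w' → ∀ P : B12.RunParams, Dag.B11_main (leavesP w' P) := by
  intro hall
  obtain ⟨w', hw', hnot⟩ := exists_record₅C_not_b11_main h
  exact hnot ⟨0, F.m, 1⟩ (hall D w' hw' _)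

/-- **N07 is UNDETERMINED over `IsRecordOfRecord₅C`** (absolute form; records exist on every family by dag-n24-a's `Node00.N24_exists_isRecordOfRecord₅C`): it
HOLDS at every run of some record and FAILS at every run of another.  The [B11] group must be PINNED before `stub_N07` is typed over a record predicate.
[cite: Balaban1985Variational, Thm 1 p.279, Props 2–9 pp.281–309 (bookkeeping over NODE 00's record predicate of record)] -/
theorem b11_main_undetermined_over_record₅C (F : T4Family) (N : ℕ) [NeZero N] :
    (∃ (D : FiniteEpsData F (SU N)) (w : WorldP), IsRecordOfRecord₅C F N D w ∧ ∀ P : B12.RunParams, Dag.B11_main (leavesP w P)) ∧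
    (∃ (D : FiniteEpsData F (SU N)) (w : WorldP), IsRecordOfRecord₅C F N D w ∧ ∀ P : B12.RunParams, ¬ Dag.B11_main (leavesP w P)) := by
  obtain ⟨D, w, h⟩ := N24_exists_isRecordOfRecord₅C F N
  obtain ⟨w₁, hw₁, h₁⟩ := exists_record₅C_b11_main h
  obtain ⟨w₀, hw₀, h₀⟩ := exists_record₅C_not_b11_main h
  exact ⟨⟨D, w₁, hw₁, fun P => (h₁ P).2⟩, ⟨D, w₀, hw₀, h₀⟩⟩

/-- **Given ONE ₈C record, there is an ₈C record over the SAME datum at which N07 FAILS at every run** (the Stage-8 overwrites do not touch `X`, `Y`, `Z`).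
[cite: Balaban1985Variational, Thm 1 p.279 (bookkeeping over NODE 00's Stage-8 record predicate)] -/
theorem exists_record₈C_not_b11_main (h : IsRecordOfRecord₈C F N D w) :
    ∃ w' : WorldP, IsRecordOfRecord₈C F N D w' ∧ ∀ P : B12.RunParams, ¬ Dag.B11_main (leavesP w' P) := by
  obtain ⟨θ, -, -, hrec⟩ := isRecordOfRecord₈C_updXYZ h
  obtain ⟨Y₁, -, -, -, hY₁⟩ := B9LeafKnitNonVacuity.exists_b9LeafX_of_vanishing_operators
  obtain ⟨Z₀, -, hZ₀⟩ := exists_not_b11Leaf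
  let X' : B12.RunParams → PrintedCarriersR := fun P =>
    { θ.res.X P with
      I8a := PEmpty, I8b := PEmpty, I8c := PEmpty, I8d := PEmpty, loc8 := fun i => i.elim, fam8 := fun i => i.elim,
      lan8 := fun i => i.elim, cub8 := fun i => i.elim, toAxial8 := fun i => i.elim, C140 := fun i => i.elim, InR := fun i => i.elim,
      proj140 := fun i => i.elim }
  let Y' : B12.RunParams → PrintedCarriers9X := fun _ => Y₁
  refine ⟨_, hrec X' Y' (fun _ => Z₀), fun P hN => hZ₀ ?_⟩
  let θ' : Stage5Params F N := Stage8Params.toStage5 F N { θ with res := { θ.res with X := X', Y := Y', Z := fun _ => Z₀ } }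
  have hθ' := upOfRecord₅C_b8_b9_b11 θ' P
  have h8 : (upOfRecord₅C F N θ' P).b8 :=
    hθ'.1.2 (@b8LeafR_of_isEmpty _ _ _ _ (inferInstance : IsEmpty PEmpty) (inferInstance : IsEmpty PEmpty)
      (inferInstance : IsEmpty PEmpty) (inferInstance : IsEmpty PEmpty) _ _ _ _ _ _ _ _ _ _ _ _ _ _ _)
  have h9 : (upOfRecord₅C F N θ' P).b9 := hθ'.2.1.2 hY₁
  exact hθ'.2.2.1 ((b11_main_iff_of_isRecordOfRecord₈C (hrec X' Y' (fun _ => Z₀)) P).1 hN h8 h9)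

/-- **Given ONE ₈C record, there is an ₈C record over the SAME datum at which the [B11] leaf — hence N07 — HOLDS at every run** (vacuously).
[cite: Balaban1985Variational, Thm 1 p.279 (bookkeeping: the `∃`-dual at Stage 8 is junk-provable)] -/
theorem exists_record₈C_b11_main (h : IsRecordOfRecord₈C F N D w) :
    ∃ w' : WorldP, IsRecordOfRecord₈C F N D w' ∧ ∀ P : B12.RunParams, (leavesP w' P).b11 ∧ Dag.B11_main (leavesP w' P) := by
  obtain ⟨θ, -, -, hrec⟩ := isRecordOfRecord₈C_updXYZ h
  obtain ⟨Z₁, -, hZ₁⟩ := exists_b11Leaf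
  refine ⟨_, hrec θ.res.X θ.res.Y (fun _ => Z₁), fun P => ?_⟩
  let θ' : Stage5Params F N := Stage8Params.toStage5 F N { θ with res := { θ.res with X := θ.res.X, Y := θ.res.Y, Z := fun _ => Z₁ } }
  have h11 : (upOfRecord₅C F N θ' P).b11 := (upOfRecord₅C_b8_b9_b11 θ' P).2.2.2 hZ₁
  exact ⟨h11, fun _ _ _ _ _ => h11⟩

/-- **«N07 at every run of every ₈C record world» is FALSE** (given one ₈C record; the absolute form follows from any inhabitation theorem of `IsRecordOfRecord₈C`,
e.g. seat dag-n23-b's `Node00/Record8Inhabited`). [cite: Balaban1985Variational, Thm 1 p.279 (bookkeeping: the universal form over the unpinned Stage-8 record is refutable)] -/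
theorem not_forall_record₈C_b11_main (h : IsRecordOfRecord₈C F N D w) :
    ¬ ∀ (D' : FiniteEpsData F (SU N)) (w' : WorldP), IsRecordOfRecord₈C F N D' w' → ∀ P : B12.RunParams, Dag.B11_main (leavesP w' P) := by
  intro hall
  obtain ⟨w', hw', hnot⟩ := exists_record₈C_not_b11_main h
  exact hnot ⟨0, F.m, 1⟩ (hall D w' hw' _)

/-- N07 is undetermined over `IsRecordOfRecord₈C`, RELATIVE form (given one ₈C record). [cite: Balaban1985Variational, Thm 1 p.279, Props 2–9 pp.281–309 (bookkeeping)] -/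
theorem b11_main_undetermined_over_record₈C (h : IsRecordOfRecord₈C F N D w) :
    (∃ w' : WorldP, IsRecordOfRecord₈C F N D w' ∧ ∀ P : B12.RunParams, Dag.B11_main (leavesP w' P)) ∧
    (∃ w' : WorldP, IsRecordOfRecord₈C F N D w' ∧ ∀ P : B12.RunParams, ¬ Dag.B11_main (leavesP w' P)) := by
  obtain ⟨w₁, hw₁, h₁⟩ := exists_record₈C_b11_main h
  exact ⟨⟨w₁, hw₁, fun P => (h₁ P).2⟩, exists_record₈C_not_b11_main h⟩

/-! ## §4 The glue a B11 pin consumes -/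

/-- **Form (b) is unsatisfiable**: at a ₅C record, «the [B11] leaf for ALL admissible Stage-5 parameters of the datum» is FALSE — swapping `Z` keeps the datum.
[cite: Balaban1985Variational, Thm 1 p.279 (bookkeeping: the [B11] group is not an object of the datum)] -/
theorem not_forall_atDatum_b11Leaf₅C (h : IsRecordOfRecord₅C F N D w) :
    ¬ ∀ θ : Stage5Params F N, θ.Admissible → D = datumOfRecord₅ F N θ → ∀ P : B12.RunParams, B11Leaf (θ.res.Z P) := by
  intro hall
  obtain ⟨θ, hθ, hD, -⟩ := h
  obtain ⟨Z₀, -, hZ₀⟩ := exists_not_b11Leaf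
  have hD' : D = datumOfRecord₅ F N ({ θ with res := { θ.res with X := θ.res.X, Y := θ.res.Y, Z := fun _ => Z₀ } } : Stage5Params F N) := by
    rw [datumOfRecord₅_updXYZ]; exact hD
  exact hZ₀ (hall _ (admissible_updXYZ hθ θ.res.X θ.res.Y fun _ => Z₀) hD' ⟨0, F.m, 1⟩)

/-- **The satisfiable Stage-5 form**: at a ₅C record, the [B11] slot «for the admissible Stage-5 parameters of the datum THAT BIND THE WORLD, the leaf of their
residual bundle» is PRECISELY the world's own leaf `(leavesP w P).b11` — the shape in which a pinning stage's theorem `B11Leaf (Z11OfRecord θ P)` is consumed.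
[cite: Balaban1985Variational, Thm 1 p.279, Props 2–9 pp.281–309 (bookkeeping: the pinned socket)] -/
theorem forall_pinned_b11Leaf_iff₅C (h : IsRecordOfRecord₅C F N D w) :
    (∀ θ : Stage5Params F N, θ.Admissible → D = datumOfRecord₅ F N θ → (∀ P, w.up P = upOfRecord₅C F N θ P) →
        ∀ P : B12.RunParams, B11Leaf (θ.res.Z P)) ↔
      ∀ P : B12.RunParams, (leavesP w P).b11 := by
  refine ⟨fun hZ P => ?_, fun hw θ' _ _ hup' P => ?_⟩
  · obtain ⟨θ, hθ, hD, -, -, -, hup⟩ := h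
    show (w.up P).b11
    rw [hup P]
    exact (upOfRecord₅C_b8_b9_b11 θ P).2.2.2 (hZ θ hθ hD hup P)
  · have h11 : (w.up P).b11 := hw P
    rw [hup' P] at h11
    exact (upOfRecord₅C_b8_b9_b11 θ' P).2.2.1 h11

/-- The satisfiable Stage-8 form (the Stage-8 parameters of the datum that bind the world): again precisely the world's leaf.
[cite: Balaban1985Variational, Thm 1 p.279, Props 2–9 pp.281–309 (bookkeeping: the pinned socket at Stage 8)] -/
theorem forall_pinned_b11Leaf_iff₈C (h : IsRecordOfRecord₈C F N D w) :
    (∀ θ : Stage8Params F N, θ.Admissible → D = datumOfRecord₅ F N (θ.toStage5 F N) →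
        (∀ P, w.up P = upOfRecord₅C F N (θ.toStage5 F N) P) → ∀ P : B12.RunParams, B11Leaf ((θ.toStage5 F N).res.Z P)) ↔
      ∀ P : B12.RunParams, (leavesP w P).b11 := by
  refine ⟨fun hZ P => ?_, fun hw θ' _ _ hup' P => ?_⟩
  · obtain ⟨θ, hθ, hD, -, -, -, hup⟩ := h
    show (w.up P).b11
    rw [hup P]
    exact (upOfRecord₅C_b8_b9_b11 (θ.toStage5 F N) P).2.2.2 (hZ θ hθ hD hup P)
  · have h11 : (w.up P).b11 := hw P
    rw [hup' P] at h11
    exact (upOfRecord₅C_b8_b9_b11 (θ'.toStage5 F N) P).2.2.1 h11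

/-- **N07 at a world bound by the C-binding of record at `θ`, `P`, from the leaf of the residual [B11] bundle** (any stage; no record predicate needed beyond the
binding equation and Stage-1 admissibility of `θ`): the socket a pin's theorem `B11Leaf (θ.res.Z P)` plugs into. [cite: Balaban1985Variational, Thm 1 p.279, Props 2–9 pp.281–309 (bookkeeping: the node from its own leaf)] -/
theorem b11_main_of_upOfRecord₅C_of_b11Leaf (θ : Stage5Params F N) (P : B12.RunParams) (hP : w.up P = upOfRecord₅C F N θ P)
    (hZ : B11Leaf (θ.res.Z P)) : Dag.B11_main (leavesP w P) := by
  intro _ _ _ _ _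
  show (w.up P).b11
  rw [hP]
  exact (upOfRecord₅C_b8_b9_b11 θ P).2.2.2 hZ

/-- **N07 at a ₅C record from the world's own [B11] leaf** (cf. `Node00.N03_at_record₅C`: there the leaf is a theorem of the record; here it is the displayed input
a B11-pinning stage must turn into a theorem). [cite: Balaban1985Variational, Thm 1 p.279, Props 2–9 pp.281–309 (bookkeeping)] -/
theorem b11_main_of_isRecordOfRecord₅C_of_leaf (h : IsRecordOfRecord₅C F N D w) (hZ : ∀ P : B12.RunParams, (leavesP w P).b11)
    (P : B12.RunParams) : Dag.B11_main (leavesP w P) :=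
  (b11_main_iff_of_isRecordOfRecord₅C h P).2 fun _ _ => hZ P

/-- N07 at an ₈C record from the world's own [B11] leaf. [cite: Balaban1985Variational, Thm 1 p.279, Props 2–9 pp.281–309 (bookkeeping)] -/
theorem b11_main_of_isRecordOfRecord₈C_of_leaf (h : IsRecordOfRecord₈C F N D w) (hZ : ∀ P : B12.RunParams, (leavesP w P).b11)
    (P : B12.RunParams) : Dag.B11_main (leavesP w P) :=
  (b11_main_iff_of_isRecordOfRecord₈C h P).2 fun _ _ => hZ P

end Literature.MathematicalPhysics.QuantumFieldTheory.Balaban1983to89.B11LeafUnpinnedRecord
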